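import Mathlib
import Summits.ValiantsHypothesis.ValiantsHypothesis.Theorems.LiouvilleSarnakAlignedTypeICharactersMod2nBilinearSievePostnikovOdd
import Summits.ValiantsHypothesis.ValiantsHypothesis.Theorems.LiouvilleSarnakAlignedTypeICharactersMod2nBilinearSievePostnikovLogPoly
import HarnessLib

/-!
# Route LiouvilleSarnak — support `AlignedTypeI` (stmt-ValiantsHypothesis-21040), line `characters_mod_2n`:
# Postnikov's formula for characters mod `2^{n+τ}` (the truncated `2`-adic logarithm)

Seventh brick for `HS`, assembling bricks 2–6: with `R = n + τ`, `s = v₂(R!)` and the INTEGER polynomial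
`Λ₀(v) = Σ_{m<R} (−1)^m (R!/(m+1)) (2^τ v)^{m+1}` (`= R!·log(1 + 2^τ v)` truncated), every PRIMITIVE Dirichlet character
`χ` mod `2^{n+τ}` (`n ≥ 1`, `τ ≥ 2`) satisfies

  `χ(1 + 2^τ v) = e(c Λ₀(v) / 2^{n+τ+s})`  for all `v ∈ ℕ`, with `c` ODD

(`postnikov_formula`).  The terms of `Λ₀` have `v₂((R!/(m+1)) 2^{τ(m+1)}) = s − v₂(m+1) + τ(m+1)`, so the phase is a
polynomial in `v` whose `m`-th coefficient has exact denominator `2^{n+τ−τ(m+1)+v₂(m+1)}` — the input of the Korobov–Vinogradov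
treatment of the sums `Σ_{x,y≤a} χ(1 + 2^τ n̄ xy)` (`…ShortCharSumsShift.norm_charSum_le_postnikovSums`).

Proof: `Λ := Λ₀/2^s + 2^{n+τ}B` satisfies the hypotheses of `postnikov_formula_of_log`: the homomorphism property is
`two_variable_log_congruence` at `t = 2^τ` (`τ(R+1) ≥ n+τ+s` as `s < R`), periodicity is termwise, and
`Λ₀(1)/2^{s+τ}` is odd (the `m = 0` term is `R! 2^τ`, the others are divisible by `2^{s+τ+1}`); `c` is odd by
`odd_of_postnikov_formula`.

HONEST FRAMING. Helper theorem (unconditional); the leaf `AlignedTypeI` is NOT closed here; nothing bears on `VP ≠ VNP`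
(NOT proved).
-/

set_option linter.dupNamespace false

noncomputable section

namespace Summit.ValiantsHypothesis.ValiantsHypothesis.Theorems.LiouvilleSarnak.AlignedTypeI.CharactersModTwoN

open Finset Complex

/-- **Valuations of the terms**: for `m < R`, `τ ≥ 2`, `s = v₂(R!)`:
`2^{s+τ} ∣ (R!/(m+1))·2^{τ(m+1)}`, and `2^{s+τ+1} ∣` it when `m ≥ 1`. [folklore] -/
theorem two_pow_dvd_logTerm {τ : ℕ} (hτ : 2 ≤ τ) {R m : ℕ} (hm : m < R) :
    2 ^ (padicValNat 2 R.factorial + τ) ∣ R.factorial / (m + 1) * 2 ^ (τ * (m + 1)) ∧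
    (1 ≤ m → 2 ^ (padicValNat 2 R.factorial + τ + 1) ∣ R.factorial / (m + 1) * 2 ^ (τ * (m + 1))) := by
  haveI := Fact.mk Nat.prime_two
  have hdvd : (m + 1) ∣ R.factorial := Nat.dvd_factorial (Nat.succ_pos m) (by omega)
  have hq0 : R.factorial / (m + 1) ≠ 0 :=
    (Nat.div_pos (Nat.le_of_dvd (Nat.factorial_pos R) hdvd) (Nat.succ_pos m)).ne'
  have h20 : (2 : ℕ) ^ (τ * (m + 1)) ≠ 0 := pow_ne_zero _ two_ne_zero
  have hd0 : R.factorial / (m + 1) * 2 ^ (τ * (m + 1)) ≠ 0 := mul_ne_zero hq0 h20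
  have hval : padicValNat 2 (R.factorial / (m + 1) * 2 ^ (τ * (m + 1))) =
      padicValNat 2 R.factorial - padicValNat 2 (m + 1) + τ * (m + 1) := by
    rw [padicValNat.mul hq0 h20, padicValNat.div_of_dvd hdvd, padicValNat.prime_pow]
  -- `v₂(m+1) ≤ v₂(R!)` and `v₂(m+1) ≤ m`
  have hvs : padicValNat 2 (m + 1) ≤ padicValNat 2 R.factorial :=
    (padicValNat_dvd_iff_le (Nat.factorial_pos R).ne').1 (pow_padicValNat_dvd.trans hdvd)
  have hvm : padicValNat 2 (m + 1) ≤ m := by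
    have h1 := padicValNat_le_nat_log (p := 2) (m + 1)
    have h2 : Nat.log 2 (m + 1) < m + 1 :=
      (Nat.log_lt_iff_lt_pow (by norm_num) (Nat.succ_ne_zero m)).2 Nat.lt_two_pow_self
    omega
  refine ⟨(padicValNat_dvd_iff_le hd0).2 ?_, fun h1 => (padicValNat_dvd_iff_le hd0).2 ?_⟩
  · rw [hval]
    have : padicValNat 2 (m + 1) ≤ τ * m := le_trans hvm (by nlinarith)
    have e : τ * (m + 1) = τ * m + τ := by ring
    omega
  · rw [hval]
    have : padicValNat 2 (m + 1) + 1 ≤ τ * m := by nlinarith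
    have e : τ * (m + 1) = τ * m + τ := by ring
    omega

/-- ★ **Postnikov's formula for primitive characters mod `2^{n+τ}`** (`n ≥ 1`, `τ ≥ 2`): with `R = n + τ`, `s = v₂(R!)`,
`Λ₀(v) = Σ_{m<R} (−1)^m (R!/(m+1)) (2^τ v)^{m+1}`, there is an ODD `c` with `χ(1 + 2^τ v) = e(cΛ₀(v)/2^{n+τ+s})` for all `v`.
[folklore] -/
theorem postnikov_formula {τ : ℕ} (hτ : 2 ≤ τ) {n : ℕ} (hn : 1 ≤ n) (χ : DirichletCharacter ℂ (2 ^ (n + τ)))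
    (hχ : χ.IsPrimitive) :
    ∃ c : ℕ, Odd c ∧ ∀ v : ℕ,
      χ ((1 + 2 ^ τ * v : ℕ) : ZMod (2 ^ (n + τ))) =
        Complex.exp (2 * Real.pi * I * ((c : ℂ) *
          ((∑ m ∈ Finset.range (n + τ), (-1 : ℤ) ^ m * (((n + τ).factorial / (m + 1) : ℕ) : ℤ) *
              ((2 : ℤ) ^ τ * v) ^ (m + 1) : ℤ) : ℂ)) /
          (2 : ℂ) ^ (n + τ + padicValNat 2 (n + τ).factorial)) := by
  haveI := Fact.mk Nat.prime_two
  set s : ℕ := padicValNat 2 (n + τ).factorial with hs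
  -- the integer polynomial `Λ₀` and its terms `d_m = ((n + τ)!/(m+1)) 2^{τ(m+1)}`
  set d : ℕ → ℕ := fun m => (n + τ).factorial / (m + 1) * 2 ^ (τ * (m + 1)) with hd
  set Λ₀ : ℕ → ℤ := fun v => ∑ m ∈ Finset.range (n + τ), (-1 : ℤ) ^ m * (((n + τ).factorial / (m + 1) : ℕ) : ℤ) *
    ((2 : ℤ) ^ τ * v) ^ (m + 1) with hΛ₀
  have hΛ₀d : ∀ v : ℕ, Λ₀ v = ∑ m ∈ Finset.range (n + τ), (-1 : ℤ) ^ m * ((d m : ℕ) : ℤ) * (v : ℤ) ^ (m + 1) := by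
    intro v
    simp only [hΛ₀, hd]
    refine sum_congr rfl fun m _ => ?_
    push_cast
    rw [mul_pow, ← pow_mul]
    ring
  have hdvd_d : ∀ m ∈ Finset.range (n + τ), (2 : ℤ) ^ (s + τ) ∣ ((d m : ℕ) : ℤ) := by
    intro m hm
    exact_mod_cast (two_pow_dvd_logTerm hτ (mem_range.1 hm)).1
  have hdvd_d' : ∀ m ∈ Finset.range (n + τ), 1 ≤ m → (2 : ℤ) ^ (s + τ + 1) ∣ ((d m : ℕ) : ℤ) := by
    intro m hm h1
    exact_mod_cast (two_pow_dvd_logTerm hτ (mem_range.1 hm)).2 h1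
  -- (F1) `2^{s+τ} ∣ Λ₀ v`, hence `2^s ∣ Λ₀ v`
  have hF1 : ∀ v : ℕ, (2 : ℤ) ^ (s + τ) ∣ Λ₀ v := by
    intro v
    rw [hΛ₀d]
    exact dvd_sum fun m hm => ((hdvd_d m hm).mul_left _).mul_right _
  have hF1s : ∀ v : ℕ, (2 : ℤ) ^ s ∣ Λ₀ v := fun v => (pow_dvd_pow 2 (Nat.le_add_right s τ)).trans (hF1 v)
  -- `μ v = Λ₀ v / 2^s`
  set μ : ℕ → ℤ := fun v => Λ₀ v / (2 : ℤ) ^ s with hμ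
  have hμeq : ∀ v : ℕ, Λ₀ v = (2 : ℤ) ^ s * μ v := fun v => (Int.mul_ediv_cancel' (hF1s v)).symm
  have h2s0 : (2 : ℤ) ^ s ≠ 0 := pow_ne_zero _ two_ne_zero
  -- (F3) periodicity: `a ≡ b (mod 2^n) ⟹ 2^{n+τ} ∣ μ a − μ b`
  have hF3 : ∀ a b : ℕ, a % 2 ^ n = b % 2 ^ n → (2 : ℤ) ^ (n + τ) ∣ μ a - μ b := by
    intro a b hab
    have hab' : ((2 : ℤ) ^ n) ∣ (a : ℤ) - b := by
      have h := (Nat.ModEq.dvd (hab.symm : b ≡ a [MOD 2 ^ n]))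
      push_cast at h
      exact h
    have h0 : (2 : ℤ) ^ (s + τ) * 2 ^ n ∣ Λ₀ a - Λ₀ b := by
      rw [hΛ₀d, hΛ₀d, ← sum_sub_distrib]
      refine dvd_sum fun m hm => ?_
      have h1 : ((a : ℤ) - b) ∣ (a : ℤ) ^ (m + 1) - (b : ℤ) ^ (m + 1) := sub_dvd_pow_sub_pow _ _ _
      have h2 : (2 : ℤ) ^ (s + τ) * 2 ^ n ∣ ((d m : ℕ) : ℤ) * ((a : ℤ) ^ (m + 1) - (b : ℤ) ^ (m + 1)) :=
        mul_dvd_mul (hdvd_d m hm) (hab'.trans h1)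
      have e : (-1 : ℤ) ^ m * ((d m : ℕ) : ℤ) * (a : ℤ) ^ (m + 1) - (-1) ^ m * ((d m : ℕ) : ℤ) * (b : ℤ) ^ (m + 1) =
          (-1) ^ m * (((d m : ℕ) : ℤ) * ((a : ℤ) ^ (m + 1) - (b : ℤ) ^ (m + 1))) := by ring
      rw [e]
      exact h2.mul_left _
    rw [hμeq, hμeq, ← mul_sub, pow_add, mul_assoc] at h0
    have h0' : (2 : ℤ) ^ s * (2 ^ n * 2 ^ τ) ∣ 2 ^ s * (μ a - μ b) := by
      rw [mul_comm ((2 : ℤ) ^ n)]; exact h0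
    rw [pow_add]
    exact (mul_dvd_mul_iff_left h2s0).1 h0'
  -- (F2) the homomorphism property from `two_variable_log_congruence`
  have hsR : s < n + τ := by
    have h := sub_one_mul_padicValNat_factorial_lt_of_ne_zero 2 (n := n + τ) (by omega)
    simpa [hs] using h
  have hF2 : ∀ a b : ℕ, (2 : ℤ) ^ (n + τ) ∣ μ (a + b + 2 ^ τ * a * b) - μ a - μ b := by
    intro a b
    have h := two_variable_log_congruence (n + τ) ((2 : ℤ) ^ τ) a b
    -- identify the three sums with `Λ₀`
    have e3 : (∑ m ∈ Finset.range (n + τ), (-1 : ℤ) ^ m * (((n + τ).factorial / (m + 1) : ℕ) : ℤ) *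
        ((2 : ℤ) ^ τ * a + (2 : ℤ) ^ τ * b + ((2 : ℤ) ^ τ) ^ 2 * (a * b)) ^ (m + 1)) =
        Λ₀ (a + b + 2 ^ τ * a * b) := by
      simp only [hΛ₀]
      refine sum_congr rfl fun m _ => ?_
      push_cast
      ring
    have e1 : (∑ m ∈ Finset.range (n + τ), (-1 : ℤ) ^ m * (((n + τ).factorial / (m + 1) : ℕ) : ℤ) *
        ((2 : ℤ) ^ τ * a) ^ (m + 1)) = Λ₀ a := by simp only [hΛ₀]
    have e2 : (∑ m ∈ Finset.range (n + τ), (-1 : ℤ) ^ m * (((n + τ).factorial / (m + 1) : ℕ) : ℤ) *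
        ((2 : ℤ) ^ τ * b) ^ (m + 1)) = Λ₀ b := by simp only [hΛ₀]
    rw [e1, e2, e3, ← pow_mul] at h
    have h' : (2 : ℤ) ^ (τ * ((n + τ) + 1)) ∣ Λ₀ (a + b + 2 ^ τ * a * b) - Λ₀ a - Λ₀ b := by
      have e : Λ₀ (a + b + 2 ^ τ * a * b) - Λ₀ a - Λ₀ b = -(Λ₀ a + Λ₀ b - Λ₀ (a + b + 2 ^ τ * a * b)) := by ring
      rw [e]; exact dvd_neg.2 h
    have hexp : s + (n + τ) ≤ τ * ((n + τ) + 1) := by nlinarith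
    have h'' := (pow_dvd_pow (2 : ℤ) hexp).trans h'
    rw [hμeq, hμeq, hμeq, pow_add] at h''
    have e : (2 : ℤ) ^ s * μ (a + b + 2 ^ τ * a * b) - 2 ^ s * μ a - 2 ^ s * μ b =
        2 ^ s * (μ (a + b + 2 ^ τ * a * b) - μ a - μ b) := by ring
    rw [e] at h''
    exact (mul_dvd_mul_iff_left h2s0).1 h''
  -- (F4) `μ 1 = 2^τ z` with `z` odd
  have hF4 : ∃ z : ℤ, Odd z ∧ μ 1 = 2 ^ τ * z := by
    -- `(n + τ)! = 2^s O`, `O` odd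
    have hR0 : (n + τ).factorial ≠ 0 := (Nat.factorial_pos (n + τ)).ne'
    obtain ⟨O, hO⟩ : (2 ^ s : ℕ) ∣ (n + τ).factorial := pow_padicValNat_dvd
    have hOodd : Odd O := by
      refine Nat.not_even_iff_odd.1 ?_
      rw [even_iff_two_dvd]
      intro h2
      have : 2 ^ (s + 1) ∣ (n + τ).factorial := by
        rw [hO, pow_succ]; exact mul_dvd_mul_left _ h2
      exact pow_succ_padicValNat_not_dvd hR0 this
    -- split off the `m = 0` term
    obtain ⟨R', hR'⟩ : ∃ R', (n + τ) = R' + 1 := ⟨(n + τ) - 1, by omega⟩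
    have hsplit : Λ₀ 1 = ((d 0 : ℕ) : ℤ) +
        ∑ m ∈ Finset.range R', (-1 : ℤ) ^ (m + 1) * ((d (m + 1) : ℕ) : ℤ) * (1 : ℤ) ^ (m + 1 + 1) := by
      rw [hΛ₀d, hR', Finset.sum_range_succ']
      push_cast
      ring
    have hrest : (2 : ℤ) ^ (s + τ + 1) ∣
        ∑ m ∈ Finset.range R', (-1 : ℤ) ^ (m + 1) * ((d (m + 1) : ℕ) : ℤ) * (1 : ℤ) ^ (m + 1 + 1) := by
      refine dvd_sum fun m hm => ?_
      have hm' : m + 1 ∈ Finset.range (n + τ) := by rw [hR']; exact mem_range.2 (by have := mem_range.1 hm; omega)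
      exact ((hdvd_d' (m + 1) hm' (by omega)).mul_left _).mul_right _
    obtain ⟨E, hE⟩ := hrest
    have hd0 : ((d 0 : ℕ) : ℤ) = (2 : ℤ) ^ (s + τ) * O := by
      simp only [hd]
      rw [zero_add, Nat.div_one, mul_one, hO]
      push_cast
      ring
    refine ⟨(O : ℤ) + 2 * E, ?_, ?_⟩
    · exact ((Int.odd_coe_nat O).2 hOodd).add_even (even_two_mul E)
    · have h1 : Λ₀ 1 = (2 : ℤ) ^ s * (2 ^ τ * ((O : ℤ) + 2 * E)) := by
        rw [hsplit, hE, hd0]; ring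
      rw [hμeq] at h1
      exact mul_left_cancel₀ h2s0 h1
  obtain ⟨z, hzodd, hz⟩ := hF4
  -- the shifted logarithm `Λ = μ + 2^{n+τ} B`, with `Λ 1 = 2^τ ℓ`, `ℓ ∈ ℕ` odd
  set B : ℤ := (z.natAbs : ℤ) with hB
  set Λ : ℕ → ℤ := fun v => μ v + (2 : ℤ) ^ (n + τ) * B with hΛ
  have hℓ0 : 0 ≤ z + 2 ^ n * B := by
    have h1 : -z ≤ B := by
      rw [hB]
      have := Int.le_natAbs (a := -z)
      rwa [Int.natAbs_neg] at this
    have h2 : B ≤ 2 ^ n * B := le_mul_of_one_le_left (by positivity) (one_le_pow₀ (by norm_num))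
    linarith
  set ℓ : ℕ := (z + 2 ^ n * B).toNat with hℓ
  have hℓZ : (ℓ : ℤ) = z + 2 ^ n * B := Int.toNat_of_nonneg hℓ0
  have hℓodd : Odd ℓ := by
    have : Odd ((ℓ : ℤ)) := by
      rw [hℓZ]
      obtain ⟨n', rfl⟩ := Nat.exists_eq_add_of_le hn
      exact hzodd.add_even ⟨2 ^ n' * B, by ring⟩
    exact (Int.odd_coe_nat ℓ).1 this
  have hone : Λ 1 = 2 ^ τ * (ℓ : ℤ) := by
    simp only [hΛ]
    rw [hz, hℓZ]; ring
  have hq : (((2 ^ (n + τ) : ℕ)) : ℤ) = (2 : ℤ) ^ (n + τ) := by push_cast; ring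
  have hhom : ∀ a b : ℕ, ((Λ (a + b + 2 ^ τ * a * b) : ℤ) : ZMod (2 ^ (n + τ))) =
      (Λ a : ZMod (2 ^ (n + τ))) + (Λ b : ZMod (2 ^ (n + τ))) := by
    intro a b
    rw [← Int.cast_add, ZMod.intCast_eq_intCast_iff_dvd_sub, hq]
    have e : Λ a + Λ b - Λ (a + b + 2 ^ τ * a * b) =
        -(μ (a + b + 2 ^ τ * a * b) - μ a - μ b) + 2 ^ (n + τ) * B := by simp only [hΛ]; ring
    rw [e]
    exact (dvd_neg.2 (hF2 a b)).add (dvd_mul_right _ _)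
  have hper : ∀ a b : ℕ, a % 2 ^ n = b % 2 ^ n →
      ((Λ a : ℤ) : ZMod (2 ^ (n + τ))) = (Λ b : ZMod (2 ^ (n + τ))) := by
    intro a b hab
    rw [ZMod.intCast_eq_intCast_iff_dvd_sub, hq]
    have e : Λ b - Λ a = -(μ a - μ b) := by simp only [hΛ]; ring
    rw [e]
    exact dvd_neg.2 (hF3 a b hab)
  -- Postnikov's formula for `Λ`, oddness of `c`, and conversion to `Λ₀`
  obtain ⟨c, hc⟩ := postnikov_formula_of_log hτ n Λ hhom hper hℓodd hone χ
  have hcodd : Odd c := odd_of_postnikov_formula hτ hn Λ hhom hone χ hχ hc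
  refine ⟨c, hcodd, fun v => ?_⟩
  rw [hc v]
  apply Complex.exp_eq_exp_iff_exists_int.2
  refine ⟨(c : ℤ) * B, ?_⟩
  have hΛv : ((Λ v : ℤ) : ℂ) = ((μ v : ℤ) : ℂ) + (2 : ℂ) ^ (n + τ) * (B : ℂ) := by
    simp only [hΛ]; push_cast; ring
  have hΛ₀v : ((∑ m ∈ Finset.range (n + τ), (-1 : ℤ) ^ m * (((n + τ).factorial / (m + 1) : ℕ) : ℤ) *
      ((2 : ℤ) ^ τ * v) ^ (m + 1) : ℤ) : ℂ) = (2 : ℂ) ^ s * ((μ v : ℤ) : ℂ) := by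
    have : (∑ m ∈ Finset.range (n + τ), (-1 : ℤ) ^ m * (((n + τ).factorial / (m + 1) : ℕ) : ℤ) *
        ((2 : ℤ) ^ τ * v) ^ (m + 1)) = Λ₀ v := by simp only [hΛ₀]
    rw [this, hμeq v]; push_cast; ring
  rw [hΛv, hΛ₀v, show (n + τ + padicValNat 2 (n + τ).factorial) = (n + τ) + s by rw [hs]]
  have h2 : (2 : ℂ) ^ (n + τ) ≠ 0 := pow_ne_zero _ two_ne_zero
  have h2' : (2 : ℂ) ^ s ≠ 0 := pow_ne_zero _ two_ne_zero
  rw [pow_add]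
  push_cast
  field_simp
  ring

end Summit.ValiantsHypothesis.ValiantsHypothesis.Theorems.LiouvilleSarnak.AlignedTypeI.CharactersModTwoN
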